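import Summits.CriticalPhenomena.Ising3D.Control2DGFFChiral
import Mathlib.Tactic
import HarnessLib

/-!
# The chiral expansions `Σ b_n k_{2(s+n)} = (x/(1-x))^s` and `Σ (-1)^n b_n k_{2(s+n)} = x^s`
(cell `pub-ising3x`, seat controls-1 gen 35; NON-VACUITY of the 2D control's typed hypothesis class,
step 2 of 3 — CONTROL-ONLY)

HONEST FRAMING: lottery ticket; floor = tightest certified 3D Ising CFT bounds; no exact-solution
claim without a proof. CONTROL-ONLY (`d = 2`); nothing numerical is asserted here.

From the coefficient identities of `Control2DGFFChiral` (`gff_convolution_eq`,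
`gff_alternating_convolution_eq`) this file proves the two one-dimensional (chiral, `sl(2)`)
generalised-free-field block expansions as `HasSum` identities, for every `s > 0` and `0 < x < 1`:

* `hasSum_gffChiral_ratio` : `Σ_n b_n(s) k_{2(s+n)}(x) = (x/(1-x))^s`,
* `hasSum_gffChiral_pow`   : `Σ_n (-1)^n b_n(s) k_{2(s+n)}(x) = x^s`,

`k_{2h} = chiralBlock h`, `b_n = gffChiralCoeff s n = (s)_n²/(n!(2s+n-1)_n)`. Architecture (that of
`Literature/…/MeanFieldDecomposition`, one dimension lower): the non-negative double family
`F(n,m) = b_n a_m(s+n) x^{s+n+m}` (`gffDouble`) is re-indexed by anti-diagonals (`gffDiag`,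
`gffReindex`), whose row sums are the finite convolutions `(s)_K/K! x^{s+K}`; Tonelli
(`summable_prod_of_nonneg`) and Mathlib's binomial series (`hasSum_poch_div_factorial_mul_pow`) give
`Σ F = x^s (1-x)^{-s}`, and the rows of `F` are `b_n k_{2(s+n)}(x)`. The signed family is absolutely
summable by comparison and its anti-diagonal sums vanish except at `K = 0`.

References: A. L. Fitzpatrick, J. Kaplan, JHEP 10 (2012) 032, §2.2 [cite: FitzpatrickKaplan2012, §2.2];
F. A. Dolan, H. Osborn, Nucl. Phys. B 678 (2004) 491, §3 [cite: DolanOsborn2004, §3]. Mathlib: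
`summable_prod_of_nonneg`, `HasSum.prod_fiberwise`, `Function.Injective.hasSum_iff`,
`Summable.of_norm_bounded`, `hasSum_sum_of_ne_finset_zero`, `hasSum_ite_eq`.
-/

namespace Summit.CriticalPhenomena.Ising3D.Control2D

open Finset Set
open Literature.MathematicalPhysics.QuantumFieldTheory.ConformalBootstrap3D

section Series

variable {s x : ℝ}

/-- The non-negative double family `F(n,m) = b_n(s) a_m(s+n) x^{(s+n)+m}` whose row sums are
`b_n k_{2(s+n)}(x)` and whose anti-diagonal sums are `(s)_K/K! · x^{s+K}`. [folklore] -/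
noncomputable def gffDouble (s x : ℝ) (nm : ℕ × ℕ) : ℝ :=
  gffChiralCoeff s nm.1 * (chiralCoeff (s + nm.1) nm.2 * x ^ (s + (nm.1 : ℝ) + (nm.2 : ℝ)))

/-- The same family re-indexed by anti-diagonals: `G(K,n) = F(n, K-n)` for `n ≤ K`, else `0`. [folklore] -/
noncomputable def gffDiag (s x : ℝ) (Kn : ℕ × ℕ) : ℝ :=
  if Kn.2 ≤ Kn.1 then gffDouble s x (Kn.2, Kn.1 - Kn.2) else 0

/-- The anti-diagonal re-indexing map `(n, m) ↦ (n + m, n)`. [folklore] -/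
def gffReindex (nm : ℕ × ℕ) : ℕ × ℕ := (nm.1 + nm.2, nm.1)

/-- The re-indexing map is injective. [folklore] -/
theorem gffReindex_injective : Function.Injective gffReindex := by
  intro a b h
  simp only [gffReindex, Prod.mk.injEq] at h
  obtain ⟨h1, h2⟩ := h
  ext
  · exact h2
  · omega

/-- `G ∘ (n,m ↦ (n+m,n)) = F`. [folklore] -/
theorem gffDiag_comp_reindex (s x : ℝ) : gffDiag s x ∘ gffReindex = gffDouble s x := by
  funext nm
  simp [gffDiag, gffReindex, Function.comp]

/-- `G` vanishes off the range of the re-indexing map (`n > K`). [folklore] -/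
theorem gffDiag_eq_zero_of_not_mem_range (s x : ℝ) (Kn : ℕ × ℕ) (h : Kn ∉ Set.range gffReindex) :
    gffDiag s x Kn = 0 := by
  unfold gffDiag
  split_ifs with hle
  · exfalso
    apply h
    exact ⟨(Kn.2, Kn.1 - Kn.2), Prod.ext (by simp [gffReindex]; omega) (by simp [gffReindex])⟩
  · rfl

/-- `F ≥ 0` for `s > 0`, `x ≥ 0`. [folklore] -/
theorem gffDouble_nonneg (hs : 0 < s) (hx : 0 ≤ x) (nm : ℕ × ℕ) : 0 ≤ gffDouble s x nm := by
  unfold gffDouble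
  have h1 := gffChiralCoeff_nonneg hs nm.1
  have h2 := chiralCoeff_nonneg (by positivity : (0 : ℝ) ≤ s + nm.1) nm.2
  have h3 : 0 ≤ x ^ (s + (nm.1 : ℝ) + (nm.2 : ℝ)) := Real.rpow_nonneg hx _
  positivity

/-- `G ≥ 0` for `s > 0`, `x ≥ 0`. [folklore] -/
theorem gffDiag_nonneg (hs : 0 < s) (hx : 0 ≤ x) (Kn : ℕ × ℕ) : 0 ≤ gffDiag s x Kn := by
  unfold gffDiag
  split_ifs
  · exact gffDouble_nonneg hs hx _
  · exact le_rfl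

/-- Row sums: `Σ_m F(n,m) = b_n k_{2(s+n)}(x)`. [folklore] -/
theorem hasSum_gffDouble_row (s : ℝ) (hx : x ∈ Ioo (0 : ℝ) 1) (n : ℕ) :
    HasSum (fun m : ℕ => gffDouble s x (n, m)) (gffChiralCoeff s n * chiralBlock (s + n) x) := by
  have h := (hasSum_chiralBlock (s + n) hx.1 hx.2).mul_left (gffChiralCoeff s n)
  exact h.congr_fun fun _ => rfl

/-- Anti-diagonal sums: `Σ_n G(K,n) = (s)_K/K! · x^{s+K}` (a finite sum; coefficient identity I).
[folklore] -/
theorem hasSum_gffDiag_row (hs : 0 < s) (x : ℝ) (K : ℕ) :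
    HasSum (fun n : ℕ => gffDiag s x (K, n)) (poch s K / (K.factorial : ℝ) * x ^ (s + (K : ℝ))) := by
  have hfin : ∀ n ∉ range (K + 1), gffDiag s x (K, n) = 0 := by
    intro n hn
    rw [Finset.mem_range] at hn
    simp [gffDiag, show ¬ n ≤ K by omega]
  have hval : ∑ n ∈ range (K + 1), gffDiag s x (K, n) =
      poch s K / (K.factorial : ℝ) * x ^ (s + (K : ℝ)) := by
    have h : ∀ n ∈ range (K + 1), gffDiag s x (K, n) =
        gffChiralCoeff s n * chiralCoeff (s + n) (K - n) * x ^ (s + (K : ℝ)) := by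
      intro n hn
      rw [Finset.mem_range] at hn
      have hn' : n ≤ K := by omega
      simp only [gffDiag, if_pos hn', gffDouble]
      rw [Nat.cast_sub hn', show s + (n : ℝ) + ((K : ℝ) - n) = s + K by ring]
      ring
    rw [sum_congr rfl h, ← sum_mul, gff_convolution_eq hs K]
  rw [← hval]
  exact hasSum_sum_of_ne_finset_zero hfin

/-- **The double family is summable, with sum `x^s (1-x)^{-s}`** (Tonelli over anti-diagonals + the
binomial series). [folklore] -/
theorem hasSum_gffDouble (hs : 0 < s) (hx : x ∈ Ioo (0 : ℝ) 1) :
    HasSum (gffDouble s x) (x ^ s * (1 / (1 - x) ^ s)) := by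
  have hbin := hasSum_poch_div_factorial_mul_pow s (x := x) (by rw [abs_of_pos hx.1]; exact hx.2)
  have hdiagK : HasSum (fun K : ℕ => poch s K / (K.factorial : ℝ) * x ^ (s + (K : ℝ)))
      (x ^ s * (1 / (1 - x) ^ s)) := by
    refine (hbin.mul_left (x ^ s)).congr_fun fun K => ?_
    rw [Real.rpow_add hx.1, Real.rpow_natCast]
    ring
  have hGs : Summable (gffDiag s x) := by
    refine (summable_prod_of_nonneg (fun Kn => gffDiag_nonneg hs hx.1.le Kn)).2
      ⟨fun K => (hasSum_gffDiag_row hs x K).summable, ?_⟩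
    exact hdiagK.summable.congr fun K => ((hasSum_gffDiag_row hs x K).tsum_eq).symm
  have hG : HasSum (gffDiag s x) (x ^ s * (1 / (1 - x) ^ s)) := by
    have h1 := hGs.hasSum
    have h2 := h1.prod_fiberwise (fun K => hasSum_gffDiag_row hs x K)
    rwa [h2.unique hdiagK] at h1
  rw [← gffDiag_comp_reindex]
  exact (gffReindex_injective.hasSum_iff (gffDiag_eq_zero_of_not_mem_range s x)).2 hG

/-- **`Σ_n b_n(s) k_{2(s+n)}(x) = (x/(1-x))^s`** for `s > 0`, `0 < x < 1`: the chiral half of the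
`(u/v)^s` piece of the generalised free four-point function (row sums of `hasSum_gffDouble`).
[cite: FitzpatrickKaplan2012, §2.2] -/
theorem hasSum_gffChiral_ratio (hs : 0 < s) (hx : x ∈ Ioo (0 : ℝ) 1) :
    HasSum (fun n : ℕ => gffChiralCoeff s n * chiralBlock (s + n) x) ((x / (1 - x)) ^ s) := by
  have h := (hasSum_gffDouble hs hx).prod_fiberwise (fun n => hasSum_gffDouble_row s hx n)
  have hv : x ^ s * (1 / (1 - x) ^ s) = (x / (1 - x)) ^ s := by
    rw [Real.div_rpow hx.1.le (by linarith [hx.2])]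
    ring
  rw [← hv]
  exact h

/-- **`Σ_n (-1)^n b_n(s) k_{2(s+n)}(x) = x^s`** for `s > 0`, `0 < x < 1`: the chiral half of the `u^s`
piece (the signed family is absolutely summable by `hasSum_gffDouble`; its anti-diagonal sums vanish
except at `K = 0`, coefficient identity II). [cite: FitzpatrickKaplan2012, §2.2] -/
theorem hasSum_gffChiral_pow (hs : 0 < s) (hx : x ∈ Ioo (0 : ℝ) 1) :
    HasSum (fun n : ℕ => (-1 : ℝ) ^ n * (gffChiralCoeff s n * chiralBlock (s + n) x)) (x ^ s) := by
  set F' : ℕ × ℕ → ℝ := fun nm => (-1 : ℝ) ^ nm.1 * gffDouble s x nm with hF'_def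
  have hF's : Summable F' := by
    refine Summable.of_norm_bounded (hasSum_gffDouble hs hx).summable fun nm => ?_
    rw [hF'_def]
    dsimp only
    rw [norm_mul, norm_pow, norm_neg, norm_one, one_pow, one_mul,
      Real.norm_of_nonneg (gffDouble_nonneg hs hx.1.le nm)]
  set G' : ℕ × ℕ → ℝ := fun Kn => if Kn.2 ≤ Kn.1 then F' (Kn.2, Kn.1 - Kn.2) else 0 with hG'_def
  have hcomp : G' ∘ gffReindex = F' := by
    funext nm
    simp [hG'_def, gffReindex, Function.comp]
  have hzero : ∀ Kn, Kn ∉ Set.range gffReindex → G' Kn = 0 := by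
    intro Kn h
    rw [hG'_def]
    dsimp only
    split_ifs with hle
    · exfalso
      apply h
      exact ⟨(Kn.2, Kn.1 - Kn.2), Prod.ext (by simp [gffReindex]; omega) (by simp [gffReindex])⟩
    · rfl
  have hG' : HasSum G' (∑' nm, F' nm) := by
    have h : HasSum (G' ∘ gffReindex) (∑' nm, F' nm) := by
      rw [hcomp]
      exact hF's.hasSum
    exact (gffReindex_injective.hasSum_iff hzero).1 h
  have rows : ∀ K : ℕ, HasSum (fun n => G' (K, n))
      ((if K = 0 then (1 : ℝ) else 0) * x ^ (s + (K : ℝ))) := by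
    intro K
    have hfin : ∀ n ∉ range (K + 1), G' (K, n) = 0 := by
      intro n hn
      rw [Finset.mem_range] at hn
      simp [hG'_def, show ¬ n ≤ K by omega]
    have hval : ∑ n ∈ range (K + 1), G' (K, n) = (if K = 0 then (1 : ℝ) else 0) * x ^ (s + (K : ℝ)) := by
      have h : ∀ n ∈ range (K + 1), G' (K, n) =
          (-1 : ℝ) ^ n * (gffChiralCoeff s n * chiralCoeff (s + n) (K - n)) * x ^ (s + (K : ℝ)) := by
        intro n hn
        rw [Finset.mem_range] at hn
        have hn' : n ≤ K := by omega
        simp only [hG'_def, hF'_def, if_pos hn', gffDouble]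
        rw [Nat.cast_sub hn', show s + (n : ℝ) + ((K : ℝ) - n) = s + K by ring]
        ring
      rw [sum_congr rfl h, ← sum_mul, gff_alternating_convolution_eq hs K]
    rw [← hval]
    exact hasSum_sum_of_ne_finset_zero hfin
  have h2 := hG'.prod_fiberwise rows
  have h3 : HasSum (fun K : ℕ => (if K = 0 then (1 : ℝ) else 0) * x ^ (s + (K : ℝ))) (x ^ s) := by
    refine (hasSum_ite_eq 0 (x ^ s)).congr_fun fun K => ?_
    split_ifs with hK
    · subst hK; simp
    · simp
  have hsum : HasSum F' (x ^ s) := (h2.unique h3) ▸ hF's.hasSum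
  exact hsum.prod_fiberwise fun n => (hasSum_gffDouble_row s hx n).mul_left ((-1 : ℝ) ^ n)

end Series

end Summit.CriticalPhenomena.Ising3D.Control2D
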